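import Summits.CriticalPhenomena.CardyFormulaZ2.Theorems.CardyWickAnisotropyBoxFamilyToCardyStubZ2BoxesToRectCardyPart2
import HarnessLib

/-!
# `stub_z2BoxesToRectCardy`, part 3: the lattice sandwich for the discretised box `(0,w)×(0,h)`

Support file for line `birth` of crux `BoxFamilyToCardy` (stmt-CriticalPhenomena-14215), stub
`stub_z2BoxesToRectCardy`; second lattice half of the sibling line's `RectValue … stub_boxSandwich`
(continues part 2, the discrete arcs). For the open box `Ω = (0,w)×(0,h)` at mesh `δ > 0` with the
closed vertical sides `L`, `Rt` as crossing arcs: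

* the G02 discretisation `Ω_δ` is the full lattice box (tree, `RectBox.meshDomain_obox`), which is
  the translate `(1,1) + [0,M]×[0,N]` when `δ(M+1) < w ≤ δ(M+2)`, `δ(N+1) < h ≤ δ(N+2)`
  (`image_rectangle_eq_meshVertices`; such `M, N` exist as soon as `2δ < w, h`, `exists_nat_window`);
* on lattice configurations, `LR((1,1)+[0,M]×[0,N−1]) ⊆ C_δ(Ω; L, Rt) ⊆ LR((1,1)+[0,M]×[0,N])`
  (part 2: the discrete arcs are the extreme columns up to their top vertex), hence, by translation
  invariance (`bondPercolation_real_lrCrossingAt`), the SANDWICH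
  `crossingProb half M (N−1) ≤ discreteCrossingProb half Ω δ L Rt ≤ crossingProb half M N`
  (`box_sandwich`; registered sub-goal `rect_boxSandwichLattice`).
Also: positive rationals `p/q` are dense in `(0,∞)` (`exists_nat_ratio_btwn`, used in part 4).
No definitions are introduced.

References: S. Smirnov, C. R. Acad. Sci. Paris 333 (2001) 239, §2 [Smirnov2001];
G. Grimmett, *Percolation* (1999), §11.3 [Grimmett1999].
-/

noncomputable section

namespace Summit.CriticalPhenomena.CardyFormulaZ2.Cruxes.BoxFamilyToCardy.Birth

open Set Metric Complex MeasureTheory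
open Literature.Probability.LatticeModels Literature.Probability.Percolation
open Summit.CriticalPhenomena.CardyFormulaZ2.Cruxes.StripClusterRates.TwoClusterRateIsStationaryGap
open Summit.CriticalPhenomena.CardyFormulaZ2.Cruxes.HalfPlaneMarkDensityLaw.SketchLine
  (BoxExhaustion.openConnIn_meshDomain_of_reachable)

namespace RectLattice

variable {w h δ : ℝ}


/-! ## The lattice box as a translated lattice rectangle -/

/-- One lattice coordinate: `1 ≤ a ≤ M + 1` iff `0 < δ a < L`, when `δ(M+1) < L ≤ δ(M+2)`.
[folklore] -/
theorem coord_window_iff (hδ : 0 < δ) {L : ℝ} {M : ℕ} (hM1 : δ * (M + 1) < L) (hM2 : L ≤ δ * (M + 2))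
    (a : ℤ) : (1 ≤ a ∧ a ≤ 1 + M) ↔ (0 < δ * a ∧ δ * a < L) := by
  constructor
  · rintro ⟨h1, h2⟩
    have h1r : (1 : ℝ) ≤ a := by exact_mod_cast h1
    have h2r : (a : ℝ) ≤ 1 + M := by exact_mod_cast h2
    refine ⟨mul_pos hδ (by linarith), lt_of_le_of_lt ?_ hM1⟩
    exact mul_le_mul_of_nonneg_left (by linarith) hδ.le
  · rintro ⟨h1, h2⟩
    have har : (0 : ℝ) < a := pos_of_mul_pos_right h1 hδ.le
    have ha : (0 : ℤ) < a := by exact_mod_cast har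
    have h3 : δ * a < δ * (M + 2) := h2.trans_le hM2
    have h4 : (a : ℝ) < M + 2 := lt_of_mul_lt_mul_left h3 hδ.le
    have h5 : a < M + 2 := by exact_mod_cast h4
    omega

/-- **The lattice box is a translated lattice rectangle**: if `δ(M+1) < w ≤ δ(M+2)` and
`δ(N+1) < h ≤ δ(N+2)`, the mesh vertices of `(0,w)×(0,h)` at mesh `δ` are `(1,1) + [0,M]×[0,N]`.
[folklore] -/
theorem image_rectangle_eq_meshVertices (hδ : 0 < δ) {M N : ℕ} (hM1 : δ * (M + 1) < w)
    (hM2 : w ≤ δ * (M + 2)) (hN1 : δ * (N + 1) < h) (hN2 : h ≤ δ * (N + 2)) :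
    (· + (![1, 1] : Site 2)) '' (rectangle M N : Set (Site 2)) =
      meshVertices (Ioo (0 : ℝ) w ×ℂ Ioo (0 : ℝ) h) δ := by
  ext z
  rw [mem_image_rectangle_iff, RectBox.mem_meshVertices_obox, ← coord_window_iff hδ hM1 hM2 (z 0),
    ← coord_window_iff hδ hN1 hN2 (z 1)]
  simp only [Matrix.cons_val_zero, Matrix.cons_val_one]
  tauto

/-- The translated left side is the column `z 0 = u 0` of the translated rectangle. [folklore] -/
theorem mem_image_leftSide_iff {u z : Site 2} {M N : ℕ} :
    z ∈ (· + u) '' (leftSide M N : Set (Site 2)) ↔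
      z ∈ (· + u) '' (rectangle M N : Set (Site 2)) ∧ z 0 = u 0 := by
  constructor
  · rintro ⟨b, hb, rfl⟩
    obtain ⟨hb1, hb2⟩ := Finset.mem_filter.1 (Finset.mem_coe.1 hb)
    exact ⟨⟨b, Finset.mem_coe.2 hb1, rfl⟩, by simp [hb2]⟩
  · rintro ⟨⟨b, hb, rfl⟩, h0⟩
    refine ⟨b, Finset.mem_coe.2 (Finset.mem_filter.2 ⟨Finset.mem_coe.1 hb, ?_⟩), rfl⟩
    simpa using h0

/-- The translated right side is the column `z 0 = u 0 + M` of the translated rectangle. [folklore] -/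
theorem mem_image_rightSide_iff {u z : Site 2} {M N : ℕ} :
    z ∈ (· + u) '' (rightSide M N : Set (Site 2)) ↔
      z ∈ (· + u) '' (rectangle M N : Set (Site 2)) ∧ z 0 = u 0 + M := by
  constructor
  · rintro ⟨b, hb, rfl⟩
    obtain ⟨hb1, hb2⟩ := Finset.mem_filter.1 (Finset.mem_coe.1 hb)
    refine ⟨⟨b, Finset.mem_coe.2 hb1, rfl⟩, ?_⟩
    simp only [Pi.add_apply, hb2]
    ring
  · rintro ⟨⟨b, hb, rfl⟩, h0⟩
    refine ⟨b, Finset.mem_coe.2 (Finset.mem_filter.2 ⟨Finset.mem_coe.1 hb, ?_⟩), rfl⟩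
    simp only [Pi.add_apply] at h0
    omega

/-! ## The event sandwich -/

/-- **Upper inclusion.** Smirnov's crossing event of the box between its vertical sides is contained
in the left-right crossing event of the translated lattice rectangle `(1,1) + [0,M]×[0,N]`.
[folklore] -/
theorem discreteCrossing_subset_lrCrossingAt (hw : 0 < w) (hh : 0 < h) (hδ : 0 < δ) {M N : ℕ}
    (hM1 : δ * (M + 1) < w) (hM2 : w ≤ δ * (M + 2)) (hN1 : δ * (N + 1) < h) (hN2 : h ≤ δ * (N + 2))
    {ω : BondConfig (Site 2)}
    (hω : ω ∈ discreteCrossing (Ioo (0 : ℝ) w ×ℂ Ioo (0 : ℝ) h) δ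
      {z : ℂ | z.re = 0 ∧ 0 ≤ z.im ∧ z.im ≤ h} {z : ℂ | z.re = w ∧ 0 ≤ z.im ∧ z.im ≤ h}) :
    ω ∈ lrCrossingAt ![1, 1] M N := by
  obtain ⟨x, hx, y, hy, hr⟩ := hω
  have hxD : x ∈ meshDomain (Ioo (0 : ℝ) w ×ℂ Ioo (0 : ℝ) h) δ :=
    meshBoundary_subset_meshDomain _ _ (discreteArc_subset_meshBoundary _ _ _ hx)
  have hconn := BoxExhaustion.openConnIn_meshDomain_of_reachable hxD hr
  rw [RectBox.meshDomain_obox hδ, ← image_rectangle_eq_meshVertices hδ hM1 hM2 hN1 hN2] at hconn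
  obtain ⟨hxV, hx0⟩ := discreteArc_leftSide_subset hw hh hδ hx
  obtain ⟨hyV, hy0⟩ := discreteArc_rightSide_subset hw hh hδ hy
  rw [lrCrossingAt, mem_openCrossing_iff]
  refine ⟨x, mem_image_leftSide_iff.2 ⟨hconn.1, by simpa using hx0⟩, y,
    mem_image_rightSide_iff.2 ⟨hconn.2.1, ?_⟩, hconn⟩
  have hyR := mem_image_rectangle_iff.1 hconn.2.1
  simp only [Matrix.cons_val_zero] at hyR ⊢
  have h1 : δ * (M + 1) < δ * (y 0 + 1) := hM1.trans_le hy0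
  have h2 : (M : ℝ) + 1 < y 0 + 1 := lt_of_mul_lt_mul_left h1 hδ.le
  have h3 : (M : ℤ) < y 0 := by exact_mod_cast (by linarith : (M : ℝ) < y 0)
  omega

/-- **Lower inclusion.** On a lattice configuration, a left-right crossing of the translated lattice
rectangle `(1,1) + [0,M]×[0,N−1]` (all rows but the top one) is a Smirnov crossing of the box between
its vertical sides (`M, N ≥ 1`). [folklore] -/
theorem lrCrossingAt_subset_discreteCrossing (hw : 0 < w) (hh : 0 < h) (hδ : 0 < δ) {M N : ℕ}
    (hM : 1 ≤ M) (hN : 1 ≤ N)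
    (hM1 : δ * (M + 1) < w) (hM2 : w ≤ δ * (M + 2)) (hN1 : δ * (N + 1) < h) (hN2 : h ≤ δ * (N + 2))
    {ω : BondConfig (Site 2)} (hωE : ω ⊆ (zdGraph 2).edgeSet) (hω : ω ∈ lrCrossingAt ![1, 1] M (N - 1)) :
    ω ∈ discreteCrossing (Ioo (0 : ℝ) w ×ℂ Ioo (0 : ℝ) h) δ
      {z : ℂ | z.re = 0 ∧ 0 ≤ z.im ∧ z.im ≤ h} {z : ℂ | z.re = w ∧ 0 ≤ z.im ∧ z.im ≤ h} := by
  rw [lrCrossingAt, mem_openCrossing_iff] at hω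
  obtain ⟨x, hx, y, hy, hconn⟩ := hω
  obtain ⟨hxR, hx0⟩ := mem_image_leftSide_iff.1 hx
  obtain ⟨hyR, hy0⟩ := mem_image_rightSide_iff.1 hy
  simp only [Matrix.cons_val_zero] at hx0 hy0
  -- the shorter rectangle sits inside the lattice box
  have hsub : (· + (![1, 1] : Site 2)) '' (rectangle M (N - 1) : Set (Site 2)) ⊆
      meshVertices (Ioo (0 : ℝ) w ×ℂ Ioo (0 : ℝ) h) δ := by
    rw [← image_rectangle_eq_meshVertices hδ hM1 hM2 hN1 hN2]
    rintro _ ⟨b, hb, rfl⟩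
    exact ⟨b, Finset.mem_coe.2 (rectangle_mono le_rfl (Nat.sub_le N 1) (Finset.mem_coe.1 hb)), rfl⟩
  have hreach := RectBox.reachable_of_openConnIn_obox hδ hωE (openConnIn_mono hsub x y hconn)
  have hxR' := mem_image_rectangle_iff.1 hxR
  have hyR' := mem_image_rectangle_iff.1 hyR
  simp only [Matrix.cons_val_zero, Matrix.cons_val_one] at hxR' hyR'
  have h2δ : 2 * δ ≤ w := by
    have : (2 : ℝ) ≤ M + 1 := by
      have : (1 : ℝ) ≤ M := by exact_mod_cast hM
      linarith
    nlinarith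
  have hrow : ∀ z : Site 2, z 1 ≤ 1 + ((N - 1 : ℕ) : ℤ) → δ * (z 1 + 1) ≤ h := by
    intro z hz
    have hz' : z 1 ≤ N := by omega
    have hzr : (z 1 : ℝ) ≤ N := by exact_mod_cast hz'
    have : δ * (z 1 + 1) ≤ δ * (N + 1) := mul_le_mul_of_nonneg_left (by linarith) hδ.le
    linarith
  refine ⟨x, mem_discreteArc_leftSide hw hh hδ h2δ (hsub hxR) hx0 (hrow x hxR'.2.2.2), y,
    mem_discreteArc_rightSide hw hh hδ (hsub hyR) ?_ (hrow y hyR'.2.2.2), hreach⟩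
  have : (y 0 : ℝ) = 1 + M := by exact_mod_cast hy0
  rw [this]
  linarith

/-! ## Lattice windows and rational aspect ratios -/

/-- **Lattice window.** For `2δ < L` there is `M ≥ 1` with `δ(M+1) < L ≤ δ(M+2)` (namely
`M = ⌈L/δ⌉ − 2`). [folklore] -/
theorem exists_nat_window {δ L : ℝ} (hδ : 0 < δ) (hL : 2 * δ < L) :
    ∃ M : ℕ, 1 ≤ M ∧ δ * (M + 1) < L ∧ L ≤ δ * (M + 2) := by
  set x : ℝ := L / δ with hx
  have hx2 : (2 : ℝ) < x := by rw [hx, lt_div_iff₀ hδ]; linarith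
  have hx0 : 0 ≤ x := by linarith
  have hc3 : 3 ≤ ⌈x⌉₊ := by
    have : (2 : ℕ) < ⌈x⌉₊ := Nat.lt_ceil.2 (by exact_mod_cast hx2)
    omega
  refine ⟨⌈x⌉₊ - 2, by omega, ?_, ?_⟩
  · have hlt : (⌈x⌉₊ : ℝ) < x + 1 := Nat.ceil_lt_add_one hx0
    have e : ((⌈x⌉₊ - 2 : ℕ) : ℝ) + 1 = (⌈x⌉₊ : ℝ) - 1 := by
      rw [Nat.cast_sub (by omega)]; push_cast; ring
    rw [e]
    have : (⌈x⌉₊ : ℝ) - 1 < L / δ := by rw [← hx]; linarith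
    rw [lt_div_iff₀ hδ] at this
    linarith
  · have hle : x ≤ (⌈x⌉₊ : ℝ) := Nat.le_ceil x
    have e : ((⌈x⌉₊ - 2 : ℕ) : ℝ) + 2 = (⌈x⌉₊ : ℝ) := by
      rw [Nat.cast_sub (by omega)]; push_cast; ring
    rw [e]
    have : L / δ ≤ (⌈x⌉₊ : ℝ) := by rw [← hx]; exact hle
    rw [div_le_iff₀ hδ] at this
    linarith

/-- **Positive rationals are dense**: between `0 ≤ lo < hi` there is `p/q` with `p, q ≥ 1`. [folklore] -/
theorem exists_nat_ratio_btwn {lo hi : ℝ} (hlo : 0 ≤ lo) (h : lo < hi) :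
    ∃ p q : ℕ, 1 ≤ p ∧ 1 ≤ q ∧ lo < (p : ℝ) / q ∧ (p : ℝ) / q < hi := by
  obtain ⟨n, hn⟩ := exists_nat_one_div_lt (sub_pos.2 h)
  set q : ℕ := n + 1 with hq
  have hqr : (0 : ℝ) < q := by rw [hq]; positivity
  have hqn : (q : ℝ) = n + 1 := by rw [hq]; push_cast; ring
  have hgap : 1 < (hi - lo) * q := by
    rw [hqn]
    have h1 : (0 : ℝ) < n + 1 := by positivity
    rw [div_lt_iff₀ h1] at hn
    linarith
  set p : ℕ := ⌊lo * q⌋₊ + 1 with hp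
  have hpr : (p : ℝ) = ⌊lo * q⌋₊ + 1 := by rw [hp]; push_cast; ring
  have hfl : (⌊lo * q⌋₊ : ℝ) ≤ lo * q := Nat.floor_le (by positivity)
  have hlt : lo * q < (⌊lo * q⌋₊ : ℝ) + 1 := Nat.lt_floor_add_one _
  refine ⟨p, q, by omega, by omega, ?_, ?_⟩
  · rw [lt_div_iff₀ hqr, hpr]; exact hlt
  · rw [div_lt_iff₀ hqr, hpr]; nlinarith


end RectLattice

open RectLattice in
/-- **The lattice sandwich for the discretised box.** For `Ω = (0,w)×(0,h)` at mesh `δ > 0` with the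
closed vertical sides as crossing arcs, and `M, N ≥ 1` with `δ(M+1) < w ≤ δ(M+2)`,
`δ(N+1) < h ≤ δ(N+2)` (so that `Ω_δ = (1,1) + [0,M]×[0,N]`), Smirnov's crossing probability at
`p = 1/2` is squeezed between the left-right crossing probabilities of the lattice rectangles
`[0,M]×[0,N−1]` and `[0,M]×[0,N]`. [folklore] -/
theorem box_sandwich {w h δ : ℝ} (hw : 0 < w) (hh : 0 < h) (hδ : 0 < δ) {M N : ℕ} (hM : 1 ≤ M) (hN : 1 ≤ N)
    (hM1 : δ * (M + 1) < w) (hM2 : w ≤ δ * (M + 2)) (hN1 : δ * (N + 1) < h) (hN2 : h ≤ δ * (N + 2)) :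
    crossingProb half M (N - 1) ≤
      discreteCrossingProb half (Set.Ioo (0 : ℝ) w ×ℂ Set.Ioo (0 : ℝ) h) δ
        {z : ℂ | z.re = 0 ∧ 0 ≤ z.im ∧ z.im ≤ h} {z : ℂ | z.re = w ∧ 0 ≤ z.im ∧ z.im ≤ h} ∧
    discreteCrossingProb half (Set.Ioo (0 : ℝ) w ×ℂ Set.Ioo (0 : ℝ) h) δ
        {z : ℂ | z.re = 0 ∧ 0 ≤ z.im ∧ z.im ≤ h} {z : ℂ | z.re = w ∧ 0 ≤ z.im ∧ z.im ≤ h} ≤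
      crossingProb half M N := by
  unfold discreteCrossingProb
  constructor
  · rw [← bondPercolation_real_lrCrossingAt half ![1, 1] M (N - 1)]
    refine ENNReal.toReal_mono (measure_ne_top _ _) (measure_mono_ae ?_)
    filter_upwards [ae_subset_edgeSet (zdGraph 2) half] with ω hω hc
    exact lrCrossingAt_subset_discreteCrossing hw hh hδ hM hN hM1 hM2 hN1 hN2 hω hc
  · rw [← bondPercolation_real_lrCrossingAt half ![1, 1] M N]
    refine ENNReal.toReal_mono (measure_ne_top _ _) (measure_mono_ae ?_)
    filter_upwards with ω hc
    exact discreteCrossing_subset_lrCrossingAt hw hh hδ hM1 hM2 hN1 hN2 hc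


open RectLattice in
/-- **Registered sub-goal `rect_boxSandwichLattice`** (part 3 of stub `stub_z2BoxesToRectCardy`): the
lattice sandwich `crossingProb half M (N−1) ≤ P_½(C_δ((0,w)×(0,h); L, Rt)) ≤ crossingProb half M N`
for `δ(M+1) < w ≤ δ(M+2)`, `δ(N+1) < h ≤ δ(N+2)`, `M, N ≥ 1`. [folklore] -/
theorem rect_boxSandwichLattice : ∀ (w h δ : ℝ), 0 < w → 0 < h → 0 < δ → ∀ M N : ℕ, 1 ≤ M → 1 ≤ N →
    δ * (M + 1) < w → w ≤ δ * (M + 2) → δ * (N + 1) < h → h ≤ δ * (N + 2) →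
    Literature.Probability.Percolation.crossingProb Literature.Probability.Percolation.half M (N - 1) ≤
      Literature.Probability.Percolation.discreteCrossingProb Literature.Probability.Percolation.half
        (Set.Ioo (0:ℝ) w ×ℂ Set.Ioo (0:ℝ) h) δ
        {z : ℂ | z.re = 0 ∧ 0 ≤ z.im ∧ z.im ≤ h} {z : ℂ | z.re = w ∧ 0 ≤ z.im ∧ z.im ≤ h} ∧
    Literature.Probability.Percolation.discreteCrossingProb Literature.Probability.Percolation.half
        (Set.Ioo (0:ℝ) w ×ℂ Set.Ioo (0:ℝ) h) δ
        {z : ℂ | z.re = 0 ∧ 0 ≤ z.im ∧ z.im ≤ h} {z : ℂ | z.re = w ∧ 0 ≤ z.im ∧ z.im ≤ h} ≤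
      Literature.Probability.Percolation.crossingProb Literature.Probability.Percolation.half M N :=
  fun _ _ _ hw hh hδ _ _ hM hN hM1 hM2 hN1 hN2 => box_sandwich hw hh hδ hM hN hM1 hM2 hN1 hN2


end Summit.CriticalPhenomena.CardyFormulaZ2.Cruxes.BoxFamilyToCardy.Birth

end
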